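import Summits.QuantumFields.BalabanUV.Beta.GAN24.Lin4Additive

/-!
# `BalabanUV.Beta.GAN24.T2UnitSplitLevels` — binder row G-an2-4 / (CONV-C), W-slot, road «W3» (F1): THE n-LEVEL UNROLLING OF THE
# NORMALISED T₂ RECURSION — `hsplit` OF THE ROW OWNER's ENDs `WSlotT2OfPieces.shape_of_rows` / `rate_of_rows`, IN an2's CURRENCY
# (G-an2-4 FORMAL swarm, leaf-01 lineage, gen 14; part 3 of «W3-L1 T2SPLIT*» — the order-4 twin of `E3UnitSplitSum.e3Of_succ_succ_decomp`)

NOT IN PRINT; OUR BOOKKEEPING.  HONEST FRAMING (cell contract, verbatim): «discharging `BetaPertH` makes Bałaban's UV stability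
UNCONDITIONAL — a real constructive-QFT result; it is NOT the continuum limit and NOT the Clay problem.»  HONEST DEPENDENCY (verbatim):
«continuum YM on T⁴ ⇐ BetaPertH ∧ nine spine estimates (0/9 proved); BetaPertH ⇐ (D1) ∧ (D4) ∧ CAP+tail; G-an2-4 gates asym, D1 and
NE2/3/4.»

WHAT.  In the K-slot units `(sfStep Lc j, smStep d Lc j)` write `T♮_j := unitS₂ … (T2Of d Lc cE cVH cΛ cE₂ cB Tc vh₂S mixFF j)`,
`K♮_j := unitK … (KInvStep Lc j)`, `S♮_j`, `M♮_j`, `M₂♮_j` for the normalised step-`j` data, `c₄ := cE₂·Lc^{2(d+1)}`,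
`𝒜_j := lin4 c₄ K♮_j Lc` (leaf-04's `T2RecursionAffine.lin4`, THE LINEAR PART) and
`b_j := c₄ • mmRead Lc ∘ K3OfK K♮_j Lc S♮_j M♮_j (W2SymOfK K♮_j Lc S♮_j M♮_j 0 M₂♮_j) + cB • mfNeg ∘ vh₂S` (leaf-04's bracket, THE SOURCE —
adopted as the 𝒜/b OF RECORD by the row owner, journal l.7669).  leaf-04's one-step split `T♮_{j+1} = b_j + 𝒜_j[T♮_j]`
(`unitS₂_T2Of_succ_affine`) is here UNROLLED over `n` levels by the discrete Duhamel engine `AffineUnroll.eq_transport_add_sum` on the class of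
tables with uniformly bounded entries (`Lin4Additive`: `𝒜_j` is additive there and preserves it):

* `unitS₂_T2Of_succ_eq_lin4_add` — the split in `Pi` form `T♮_{j+1} = 𝒜_j T♮_j + b_j`;
* **`unitS₂_T2Of_eq_transport_add_sum`** — (F1) for END #1: `T♮_n = 𝒯 0 n T♮_0 + Σ_{i<n} 𝒯 (i+1) (n−1−i) b_i`,
  `𝒯 m k := transport (fun j ↦ lin4 c₄ K♮_j Lc) m k` (the `k`-fold composite transport from level `m`; by `Lin4Additive.transport_lin4_eq_pow_smul`
  it is `(−(cE₂ * (Lc : ℝ) ^ (2 * (d + 1))))^k •` the composite of the bare sandwiches — every power of `cE₂` displayed, (R12-3));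
* **`unitS₂_T2Of_sub_eq_transport_add_sum`** — (F1) for END #2: the DIFFERENCE tower `D_n := T♮_{n+1} − T♮_n` unrolled through the shifted
  transport with the forcing `f_i := (𝒜_{i+1} − 𝒜_i)[T♮_i] + (b_{i+1} − b_i)` (`AffineUnroll.diff_eq_transport_add_sum`);
* the same two for an1's concrete border table `vh₂S d Lc` (`…_vh₂S`), whose texts are the `hsplit` hypotheses of the owner's
  `WSlotT2OfPieces.t2Shape_of_rows` (with `P := 𝒯`, `b := b`) and `t2Drift_of_rows` (with `P m k := 𝒯 (m+1) k`, `f := f`);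
* the sequel `GAN24/T2UnitSplitShapes` discharges the per-level data from TREE theorems, leaving (F1) conditional on the border shape and
  the MIXED-TABLE SHAPE `hmix` only (for an1's `vh₂S d Lc`: on `hmix` alone).
HYPOTHESES (per level `j`, EXISTENTIAL constants — the unrolling is algebra, no uniformity is claimed or needed): leaf-04's step data `hdat`
(decay of `K♮_j` at a rate `δ_j > 0` and the `VertexFamily₂` shape of the normalised second-order member and of its `T♮`-free part at that rate —
K-slot + an2's per-member localisation) and `hbdd` (every `T♮_j` has bounded entries — an2's `T2Of_loc`).  [folklore] composition; asserts NO
bound uniform in `j`, NO zero mode, NO sum rule; «T2Shape»/«T2SupRate» OPEN, NOT IN PRINT; discharges NOTHING of (hW, hWall); NOT «W-slot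
closed», NEVER «G-an2-4 closed»; NOT BetaPertH, NOT continuum, NOT Clay.
-/

noncomputable section

open Finset
open scoped BigOperators
open Literature.MathematicalPhysics.QuantumFieldTheory
open Literature.MathematicalPhysics.QuantumFieldTheory.Balaban1983to89
open Literature.MathematicalPhysics.QuantumFieldTheory.Balaban1983to89.Beta
open B12Sec2to5 (l1 l1_nonneg)
open ExpKernelCalculus (MKer Decays VertexFamily₂)
open OneStepResolventKernel (Fib decays_mono)
open OneStepKernelFamily (KInvStep decays_KInvStep)
open StepJetData (mfNeg)
open SecondOrderResponse (W2SymOfK LocStencilFM)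
open BalabanCompositeJets (LocStencil₂)
open BalabanStepJets (vertexFamily₂_mono)
open BalabanStepJetsSucc (mmRead)
open BalabanStepW2 (K3OfK Spure M1 M2Of T2Of WbalOf T2Of_loc vertexFamily₂_WbalOf')
open AveragingMixedJetTables (vh₂S)
open KernelWard (bdd_of_biLoc)
open Summit.QuantumFields.BalabanUV.Beta.HessKerDressedUnits (unitK unitS unitW legScale abs_legScale_le decays_unitK vertexFamily₂_unitW)
open Summit.QuantumFields.BalabanUV.Beta.SecondOrderUnits (unitM unitS₂ unitM₂ unitW_WbalOf)
open Summit.QuantumFields.BalabanUV.Beta.GAN24.CombesThomas (sfStep smStep sfStep_ne_zero smStep_ne_zero)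
open Summit.QuantumFields.BalabanUV.Beta.GAN24.T2SlotUnits (unitS₂_apply vh₂S_inl_inl vh₂S_inr_inr locStencil₂_vh₂S)
open Summit.QuantumFields.BalabanUV.Beta.GAN24.T2RecursionAffine (lin4 unitS₂_T2Of_succ_affine)
open Summit.QuantumFields.BalabanUV.Beta.GAN24.AffineUnroll (transport eq_transport_add_sum diff_eq_transport_add_sum)
open Summit.QuantumFields.BalabanUV.Beta.GAN24.Lin4Additive (lin4_bdd lin4_add)

namespace Summit.QuantumFields.BalabanUV.Beta.GAN24.T2UnitSplitLevels

variable {d : ℕ}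

/-! ## §0 The class of record: tables with uniformly bounded entries -/

section Class

/-- [folklore] The zero bi-table has bounded entries. -/
theorem bdd₄_zero : ∃ B : ℝ, ∀ (κ : Fin (d + 1)) (u : Fin (d + 1) → ℤ) (κ' : Fin (d + 1)) (u' x z : Fin (d + 1) → ℤ) (a b : Fib d),
    |(0 : Fin (d + 1) → (Fin (d + 1) → ℤ) → Fin (d + 1) → (Fin (d + 1) → ℤ) → MKer (d + 1) (Fib d)) κ u κ' u' x z a b| ≤ B :=
  ⟨0, fun κ u κ' u' x z a b => by simp⟩

/-- [folklore] Sums of bounded bi-tables are bounded. -/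
theorem bdd₄_add {X Y : Fin (d + 1) → (Fin (d + 1) → ℤ) → Fin (d + 1) → (Fin (d + 1) → ℤ) → MKer (d + 1) (Fib d)}
    (hX : ∃ B : ℝ, ∀ κ u κ' u' x z a b, |X κ u κ' u' x z a b| ≤ B) (hY : ∃ B : ℝ, ∀ κ u κ' u' x z a b, |Y κ u κ' u' x z a b| ≤ B) :
    ∃ B : ℝ, ∀ κ u κ' u' x z a b, |(X + Y) κ u κ' u' x z a b| ≤ B := by
  obtain ⟨B₁, h₁⟩ := hX
  obtain ⟨B₂, h₂⟩ := hY
  refine ⟨B₁ + B₂, fun κ u κ' u' x z a b => ?_⟩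
  simp only [Pi.add_apply]
  exact (abs_add_le _ _).trans (add_le_add (h₁ κ u κ' u' x z a b) (h₂ κ u κ' u' x z a b))

/-- [folklore] Differences of bounded bi-tables are bounded. -/
theorem bdd₄_sub {X Y : Fin (d + 1) → (Fin (d + 1) → ℤ) → Fin (d + 1) → (Fin (d + 1) → ℤ) → MKer (d + 1) (Fib d)}
    (hX : ∃ B : ℝ, ∀ κ u κ' u' x z a b, |X κ u κ' u' x z a b| ≤ B) (hY : ∃ B : ℝ, ∀ κ u κ' u' x z a b, |Y κ u κ' u' x z a b| ≤ B) :
    ∃ B : ℝ, ∀ κ u κ' u' x z a b, |(X - Y) κ u κ' u' x z a b| ≤ B := by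
  obtain ⟨B₁, h₁⟩ := hX
  obtain ⟨B₂, h₂⟩ := hY
  refine ⟨B₁ + B₂, fun κ u κ' u' x z a b => ?_⟩
  simp only [Pi.sub_apply]
  exact (abs_sub _ _).trans (add_le_add (h₁ κ u κ' u' x z a b) (h₂ κ u κ' u' x z a b))

/-- [folklore] `lin4 c K N` is additive on the class of bounded bi-tables (a common bound is `B₁ + B₂`; `Lin4Additive.lin4_add`). -/
theorem lin4_add_of_bdd₄ {K : MKer (d + 1) (Fib d)} {C δ : ℝ} (hK : Decays K C δ) (hδ : 0 < δ) (c : ℝ) (N : ℕ)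
    {X Y : Fin (d + 1) → (Fin (d + 1) → ℤ) → Fin (d + 1) → (Fin (d + 1) → ℤ) → MKer (d + 1) (Fib d)}
    (hX : ∃ B : ℝ, ∀ κ u κ' u' x z a b, |X κ u κ' u' x z a b| ≤ B) (hY : ∃ B : ℝ, ∀ κ u κ' u' x z a b, |Y κ u κ' u' x z a b| ≤ B) :
    lin4 c K N (X + Y) = lin4 c K N X + lin4 c K N Y := by
  obtain ⟨B₁, h₁⟩ := hX
  obtain ⟨B₂, h₂⟩ := hY
  have hB₁ : 0 ≤ B₁ := (abs_nonneg _).trans (h₁ 0 0 0 0 0 0 (Sum.inl 0) (Sum.inl 0))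
  have hB₂ : 0 ≤ B₂ := (abs_nonneg _).trans (h₂ 0 0 0 0 0 0 (Sum.inl 0) (Sum.inl 0))
  exact lin4_add hK hδ c N (B := B₁ + B₂) (fun κ u κ' u' x z a b => (h₁ κ u κ' u' x z a b).trans (le_add_of_nonneg_right hB₂))
    (fun κ u κ' u' x z a b => (h₂ κ u κ' u' x z a b).trans (le_add_of_nonneg_left hB₁))

end Class

/-! ## §1 The level sum for a generic off-diagonal border table -/

section Generic

variable {Lc : ℕ} [NeZero Lc] (cE cVH cΛ cE₂ cB : ℝ) (Tc : Fin 4 → Fin 4 → Fin 4 → Fin 4 → ℝ)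
  (vh₂S mixFF : Fin (d + 1) → (Fin (d + 1) → ℤ) → Fin (d + 1) → (Fin (d + 1) → ℤ) → MKer (d + 1) (Fib d))


/-- [folklore] **THE AFFINE STEP IN `Pi` FORM**: `T♮_{j+1} = 𝒜_j T♮_j + b_j` (leaf-04's `unitS₂_T2Of_succ_affine`, summands commuted). -/
theorem unitS₂_T2Of_succ_eq_lin4_add
    (hBff : ∀ κ u κ' u' x z (α β : Fin (d + 1)), vh₂S κ u κ' u' x z (Sum.inl α) (Sum.inl β) = 0)
    (hBmm : ∀ κ u κ' u' x z (μ ν : Fin (d + 1)), vh₂S κ u κ' u' x z (Sum.inr μ) (Sum.inr ν) = 0) (j : ℕ) {C δ C₀ C₁ : ℝ} (hδ : 0 < δ)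
    (hK : Decays (unitK (sfStep Lc j) (smStep d Lc j) (KInvStep (d := d) Lc j)) C δ) (h₀ : VertexFamily₂ (W2SymOfK
          (unitK (sfStep Lc j) (smStep d Lc j) (KInvStep (d := d) Lc j)) Lc (unitS (sfStep Lc j) (smStep d Lc j) (Spure d Lc cE cVH cΛ j))
          (unitM (sfStep Lc j) (smStep d Lc j) (M1 d Lc cΛ j)) 0 (unitM₂ (sfStep Lc j) (smStep d Lc j) (M2Of d Lc mixFF j))) Lc C₀ δ)
    (hW : VertexFamily₂ (W2SymOfK (unitK (sfStep Lc j) (smStep d Lc j) (KInvStep (d := d) Lc j)) Lc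
          (unitS (sfStep Lc j) (smStep d Lc j) (Spure d Lc cE cVH cΛ j)) (unitM (sfStep Lc j) (smStep d Lc j) (M1 d Lc cΛ j))
          (unitS₂ (sfStep Lc j) (smStep d Lc j) (T2Of d Lc cE cVH cΛ cE₂ cB Tc vh₂S mixFF j))
          (unitM₂ (sfStep Lc j) (smStep d Lc j) (M2Of d Lc mixFF j))) Lc C₁ δ) :
    (unitS₂ (sfStep Lc (j + 1)) (smStep d Lc (j + 1)) (T2Of d Lc cE cVH cΛ cE₂ cB Tc vh₂S mixFF (j + 1))) = lin4 (cE₂ * (Lc : ℝ) ^ (2 * (d + 1)))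
          (unitK (sfStep Lc j) (smStep d Lc j) (KInvStep (d := d) Lc j)) Lc (unitS₂ (sfStep Lc j) (smStep d Lc j)
          (T2Of d Lc cE cVH cΛ cE₂ cB Tc vh₂S mixFF j)) + (fun κ u κ' u' => (cE₂ * (Lc : ℝ) ^ (2 * (d + 1))) • mmRead Lc (K3OfK
          (unitK (sfStep Lc j) (smStep d Lc j) (KInvStep (d := d) Lc j)) Lc (unitS (sfStep Lc j) (smStep d Lc j) (Spure d Lc cE cVH cΛ j))
          (unitM (sfStep Lc j) (smStep d Lc j) (M1 d Lc cΛ j)) (W2SymOfK (unitK (sfStep Lc j) (smStep d Lc j) (KInvStep (d := d) Lc j)) Lc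
          (unitS (sfStep Lc j) (smStep d Lc j) (Spure d Lc cE cVH cΛ j)) (unitM (sfStep Lc j) (smStep d Lc j) (M1 d Lc cΛ j)) 0
          (unitM₂ (sfStep Lc j) (smStep d Lc j) (M2Of d Lc mixFF j))) κ u κ' u') + cB • mfNeg (vh₂S κ u κ' u')) := by
  rw [unitS₂_T2Of_succ_affine cE cVH cΛ cE₂ cB Tc mixFF hBff hBmm j hδ hK h₀ hW]
  funext κ u κ' u'
  simp only [Pi.add_apply]
  exact add_comm _ _

/-- [folklore] **(F1) THE LEVEL SUM OF THE NORMALISED T₂ FAMILY** (`hsplit` of the row owner's END #1 `WSlotT2OfPieces.shape_of_rows` with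
`P m k := transport (fun j ↦ lin4 c₄ K♮_j Lc) m k` and `b := b♮`): for every `n`,
`T♮_n = 𝒯 0 n T♮_0 + Σ_{i ∈ range n} 𝒯 (i+1) (n−1−i) b♮_i`.  Hypotheses per level `j` with EXISTENTIAL constants: leaf-04's step data
(`Decays K♮_j C δ`, `δ > 0`, and the `VertexFamily₂` shape at rate `δ` of the normalised second-order member and of its `T♮`-free part) and bounded
entries of every `T♮_j`.  Proof: `AffineUnroll.eq_transport_add_sum` on the class of bounded bi-tables (`Lin4Additive.lin4_add`/`lin4_bdd`). -/
theorem unitS₂_T2Of_eq_transport_add_sum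
    (hBff : ∀ κ u κ' u' x z (α β : Fin (d + 1)), vh₂S κ u κ' u' x z (Sum.inl α) (Sum.inl β) = 0)
    (hBmm : ∀ κ u κ' u' x z (μ ν : Fin (d + 1)), vh₂S κ u κ' u' x z (Sum.inr μ) (Sum.inr ν) = 0)
    (hdat : ∀ j, ∃ C δ C₀ C₁ : ℝ, 0 < δ ∧ Decays (unitK (sfStep Lc j) (smStep d Lc j) (KInvStep (d := d) Lc j)) C δ ∧ VertexFamily₂ (W2SymOfK
          (unitK (sfStep Lc j) (smStep d Lc j) (KInvStep (d := d) Lc j)) Lc (unitS (sfStep Lc j) (smStep d Lc j) (Spure d Lc cE cVH cΛ j))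
          (unitM (sfStep Lc j) (smStep d Lc j) (M1 d Lc cΛ j)) 0 (unitM₂ (sfStep Lc j) (smStep d Lc j) (M2Of d Lc mixFF j))) Lc C₀ δ ∧
      VertexFamily₂ (W2SymOfK (unitK (sfStep Lc j) (smStep d Lc j) (KInvStep (d := d) Lc j)) Lc
            (unitS (sfStep Lc j) (smStep d Lc j) (Spure d Lc cE cVH cΛ j)) (unitM (sfStep Lc j) (smStep d Lc j) (M1 d Lc cΛ j))
            (unitS₂ (sfStep Lc j) (smStep d Lc j) (T2Of d Lc cE cVH cΛ cE₂ cB Tc vh₂S mixFF j))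
            (unitM₂ (sfStep Lc j) (smStep d Lc j) (M2Of d Lc mixFF j))) Lc C₁ δ)
    (hbdd : ∀ j, ∃ B : ℝ, ∀ κ u κ' u' x z a b, |(unitS₂ (sfStep Lc j) (smStep d Lc j)
          (T2Of d Lc cE cVH cΛ cE₂ cB Tc vh₂S mixFF j)) κ u κ' u' x z a b| ≤ B) (n : ℕ) :
    (unitS₂ (sfStep Lc n) (smStep d Lc n) (T2Of d Lc cE cVH cΛ cE₂ cB Tc vh₂S mixFF n)) = transport (fun j => lin4 (cE₂ * (Lc : ℝ) ^ (2 * (d + 1)))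
          (unitK (sfStep Lc j) (smStep d Lc j) (KInvStep (d := d) Lc j)) Lc) 0 n (unitS₂ (sfStep Lc 0) (smStep d Lc 0)
          (T2Of d Lc cE cVH cΛ cE₂ cB Tc vh₂S mixFF 0)) +
      ∑ i ∈ Finset.range n, transport (fun j => lin4 (cE₂ * (Lc : ℝ) ^ (2 * (d + 1)))
            (unitK (sfStep Lc j) (smStep d Lc j) (KInvStep (d := d) Lc j)) Lc) (i + 1) (n - 1 - i)
            (fun κ u κ' u' => (cE₂ * (Lc : ℝ) ^ (2 * (d + 1))) • mmRead Lc (K3OfK (unitK (sfStep Lc i) (smStep d Lc i) (KInvStep (d := d) Lc i)) Lc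
            (unitS (sfStep Lc i) (smStep d Lc i) (Spure d Lc cE cVH cΛ i)) (unitM (sfStep Lc i) (smStep d Lc i) (M1 d Lc cΛ i)) (W2SymOfK
            (unitK (sfStep Lc i) (smStep d Lc i) (KInvStep (d := d) Lc i)) Lc (unitS (sfStep Lc i) (smStep d Lc i) (Spure d Lc cE cVH cΛ i))
            (unitM (sfStep Lc i) (smStep d Lc i) (M1 d Lc cΛ i)) 0
            (unitM₂ (sfStep Lc i) (smStep d Lc i) (M2Of d Lc mixFF i))) κ u κ' u') + cB • mfNeg (vh₂S κ u κ' u')) := by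
  have hrec : ∀ j, (unitS₂ (sfStep Lc (j + 1)) (smStep d Lc (j + 1))
        (T2Of d Lc cE cVH cΛ cE₂ cB Tc vh₂S mixFF (j + 1))) = lin4 (cE₂ * (Lc : ℝ) ^ (2 * (d + 1)))
        (unitK (sfStep Lc j) (smStep d Lc j) (KInvStep (d := d) Lc j)) Lc (unitS₂ (sfStep Lc j) (smStep d Lc j)
        (T2Of d Lc cE cVH cΛ cE₂ cB Tc vh₂S mixFF j)) + (fun κ u κ' u' => (cE₂ * (Lc : ℝ) ^ (2 * (d + 1))) • mmRead Lc (K3OfK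
        (unitK (sfStep Lc j) (smStep d Lc j) (KInvStep (d := d) Lc j)) Lc (unitS (sfStep Lc j) (smStep d Lc j) (Spure d Lc cE cVH cΛ j))
        (unitM (sfStep Lc j) (smStep d Lc j) (M1 d Lc cΛ j)) (W2SymOfK (unitK (sfStep Lc j) (smStep d Lc j) (KInvStep (d := d) Lc j)) Lc
        (unitS (sfStep Lc j) (smStep d Lc j) (Spure d Lc cE cVH cΛ j)) (unitM (sfStep Lc j) (smStep d Lc j) (M1 d Lc cΛ j)) 0
        (unitM₂ (sfStep Lc j) (smStep d Lc j) (M2Of d Lc mixFF j))) κ u κ' u') + cB • mfNeg (vh₂S κ u κ' u')) := fun j => by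
    obtain ⟨C, δ, C₀, C₁, hδ, hK, h₀, hW⟩ := hdat j
    exact unitS₂_T2Of_succ_eq_lin4_add cE cVH cΛ cE₂ cB Tc vh₂S mixFF hBff hBmm j hδ hK h₀ hW
  have hAP : ∀ (j : ℕ) (X : Fin (d + 1) → (Fin (d + 1) → ℤ) → Fin (d + 1) → (Fin (d + 1) → ℤ) → MKer (d + 1) (Fib d)),
      (∃ B : ℝ, ∀ κ u κ' u' x z a b, |X κ u κ' u' x z a b| ≤ B) →
        ∃ B : ℝ, ∀ κ u κ' u' x z a b, |lin4 (cE₂ * (Lc : ℝ) ^ (2 * (d + 1)))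
              (unitK (sfStep Lc j) (smStep d Lc j) (KInvStep (d := d) Lc j)) Lc X κ u κ' u' x z a b| ≤ B := fun j X hX => by
    obtain ⟨C, δ, C₀, C₁, hδ, hK, -, -⟩ := hdat j
    exact lin4_bdd hK hδ _ Lc hX
  have hAadd : ∀ (j : ℕ) (X Y : Fin (d + 1) → (Fin (d + 1) → ℤ) → Fin (d + 1) → (Fin (d + 1) → ℤ) → MKer (d + 1) (Fib d)),
      (∃ B : ℝ, ∀ κ u κ' u' x z a b, |X κ u κ' u' x z a b| ≤ B) → (∃ B : ℝ, ∀ κ u κ' u' x z a b, |Y κ u κ' u' x z a b| ≤ B) →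
        lin4 (cE₂ * (Lc : ℝ) ^ (2 * (d + 1)))
              (unitK (sfStep Lc j) (smStep d Lc j) (KInvStep (d := d) Lc j)) Lc (X + Y) = lin4 (cE₂ * (Lc : ℝ) ^ (2 * (d + 1)))
              (unitK (sfStep Lc j) (smStep d Lc j) (KInvStep (d := d) Lc j)) Lc X + lin4 (cE₂ * (Lc : ℝ) ^ (2 * (d + 1)))
              (unitK (sfStep Lc j) (smStep d Lc j) (KInvStep (d := d) Lc j)) Lc Y := fun j X Y hX hY => by
    obtain ⟨C, δ, C₀, C₁, hδ, hK, -, -⟩ := hdat j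
    exact lin4_add_of_bdd₄ hK hδ _ Lc hX hY
  have hb : ∀ j, ∃ B : ℝ, ∀ κ u κ' u' x z a b, |(fun κ u κ' u' => (cE₂ * (Lc : ℝ) ^ (2 * (d + 1))) • mmRead Lc (K3OfK
        (unitK (sfStep Lc j) (smStep d Lc j) (KInvStep (d := d) Lc j)) Lc (unitS (sfStep Lc j) (smStep d Lc j) (Spure d Lc cE cVH cΛ j))
        (unitM (sfStep Lc j) (smStep d Lc j) (M1 d Lc cΛ j)) (W2SymOfK (unitK (sfStep Lc j) (smStep d Lc j) (KInvStep (d := d) Lc j)) Lc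
        (unitS (sfStep Lc j) (smStep d Lc j) (Spure d Lc cE cVH cΛ j)) (unitM (sfStep Lc j) (smStep d Lc j) (M1 d Lc cΛ j)) 0
        (unitM₂ (sfStep Lc j) (smStep d Lc j) (M2Of d Lc mixFF j))) κ u κ' u') + cB • mfNeg (vh₂S κ u κ' u')) κ u κ' u' x z a b| ≤ B := fun j => by
    have e : (fun κ u κ' u' => (cE₂ * (Lc : ℝ) ^ (2 * (d + 1))) • mmRead Lc (K3OfK (unitK (sfStep Lc j) (smStep d Lc j) (KInvStep (d := d) Lc j)) Lc
          (unitS (sfStep Lc j) (smStep d Lc j) (Spure d Lc cE cVH cΛ j)) (unitM (sfStep Lc j) (smStep d Lc j) (M1 d Lc cΛ j)) (W2SymOfK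
          (unitK (sfStep Lc j) (smStep d Lc j) (KInvStep (d := d) Lc j)) Lc (unitS (sfStep Lc j) (smStep d Lc j) (Spure d Lc cE cVH cΛ j))
          (unitM (sfStep Lc j) (smStep d Lc j) (M1 d Lc cΛ j)) 0
          (unitM₂ (sfStep Lc j) (smStep d Lc j) (M2Of d Lc mixFF j))) κ u κ' u') + cB • mfNeg (vh₂S κ u κ' u')) =
          (unitS₂ (sfStep Lc (j + 1)) (smStep d Lc (j + 1))
          (T2Of d Lc cE cVH cΛ cE₂ cB Tc vh₂S mixFF (j + 1))) - lin4 (cE₂ * (Lc : ℝ) ^ (2 * (d + 1)))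
          (unitK (sfStep Lc j) (smStep d Lc j) (KInvStep (d := d) Lc j)) Lc (unitS₂ (sfStep Lc j) (smStep d Lc j)
          (T2Of d Lc cE cVH cΛ cE₂ cB Tc vh₂S mixFF j)) := by rw [hrec j, add_sub_cancel_left]
    rw [e]
    exact bdd₄_sub (hbdd (j + 1)) (hAP j _ (hbdd j))
  exact eq_transport_add_sum (A := fun j => lin4 (cE₂ * (Lc : ℝ) ^ (2 * (d + 1))) (unitK (sfStep Lc j) (smStep d Lc j) (KInvStep (d := d) Lc j)) Lc)
    (P := fun X => ∃ B : ℝ, ∀ κ u κ' u' x z a b, |X κ u κ' u' x z a b| ≤ B)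
    (x := fun j => (unitS₂ (sfStep Lc j) (smStep d Lc j) (T2Of d Lc cE cVH cΛ cE₂ cB Tc vh₂S mixFF j))) (b := fun j =>
          (fun κ u κ' u' => (cE₂ * (Lc : ℝ) ^ (2 * (d + 1))) • mmRead Lc (K3OfK (unitK (sfStep Lc j) (smStep d Lc j) (KInvStep (d := d) Lc j)) Lc
          (unitS (sfStep Lc j) (smStep d Lc j) (Spure d Lc cE cVH cΛ j)) (unitM (sfStep Lc j) (smStep d Lc j) (M1 d Lc cΛ j)) (W2SymOfK
          (unitK (sfStep Lc j) (smStep d Lc j) (KInvStep (d := d) Lc j)) Lc (unitS (sfStep Lc j) (smStep d Lc j) (Spure d Lc cE cVH cΛ j))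
          (unitM (sfStep Lc j) (smStep d Lc j) (M1 d Lc cΛ j)) 0
          (unitM₂ (sfStep Lc j) (smStep d Lc j) (M2Of d Lc mixFF j))) κ u κ' u') + cB • mfNeg (vh₂S κ u κ' u'))) bdd₄_zero (fun _ _ => bdd₄_add) hAP
          hAadd (hbdd 0) hb hrec n

/-- [folklore] **(F1) FOR THE DIFFERENCE TOWER** (`hsplit` of the row owner's END #2 `WSlotT2OfPieces.rate_of_rows` with the SHIFTED transport
`P m k := transport (fun j ↦ lin4 c₄ K♮_j Lc) (m+1) k` and the forcing `f i := (𝒜_{i+1} − 𝒜_i)[T♮_i] + (b♮_{i+1} − b♮_i)`): for every `n`,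
`T♮_{n+1} − T♮_n = 𝒯 1 n (T♮_1 − T♮_0) + Σ_{i ∈ range n} 𝒯 (i+2) (n−1−i) f_i`.  Same hypotheses; `AffineUnroll.diff_eq_transport_add_sum`. -/
theorem unitS₂_T2Of_sub_eq_transport_add_sum
    (hBff : ∀ κ u κ' u' x z (α β : Fin (d + 1)), vh₂S κ u κ' u' x z (Sum.inl α) (Sum.inl β) = 0)
    (hBmm : ∀ κ u κ' u' x z (μ ν : Fin (d + 1)), vh₂S κ u κ' u' x z (Sum.inr μ) (Sum.inr ν) = 0)
    (hdat : ∀ j, ∃ C δ C₀ C₁ : ℝ, 0 < δ ∧ Decays (unitK (sfStep Lc j) (smStep d Lc j) (KInvStep (d := d) Lc j)) C δ ∧ VertexFamily₂ (W2SymOfK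
          (unitK (sfStep Lc j) (smStep d Lc j) (KInvStep (d := d) Lc j)) Lc (unitS (sfStep Lc j) (smStep d Lc j) (Spure d Lc cE cVH cΛ j))
          (unitM (sfStep Lc j) (smStep d Lc j) (M1 d Lc cΛ j)) 0 (unitM₂ (sfStep Lc j) (smStep d Lc j) (M2Of d Lc mixFF j))) Lc C₀ δ ∧
      VertexFamily₂ (W2SymOfK (unitK (sfStep Lc j) (smStep d Lc j) (KInvStep (d := d) Lc j)) Lc
            (unitS (sfStep Lc j) (smStep d Lc j) (Spure d Lc cE cVH cΛ j)) (unitM (sfStep Lc j) (smStep d Lc j) (M1 d Lc cΛ j))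
            (unitS₂ (sfStep Lc j) (smStep d Lc j) (T2Of d Lc cE cVH cΛ cE₂ cB Tc vh₂S mixFF j))
            (unitM₂ (sfStep Lc j) (smStep d Lc j) (M2Of d Lc mixFF j))) Lc C₁ δ)
    (hbdd : ∀ j, ∃ B : ℝ, ∀ κ u κ' u' x z a b, |(unitS₂ (sfStep Lc j) (smStep d Lc j)
          (T2Of d Lc cE cVH cΛ cE₂ cB Tc vh₂S mixFF j)) κ u κ' u' x z a b| ≤ B) (n : ℕ) :
    (fun κ u κ' u' => (unitS₂ (sfStep Lc (n + 1)) (smStep d Lc (n + 1)) (T2Of d Lc cE cVH cΛ cE₂ cB Tc vh₂S mixFF (n + 1))) κ u κ' u' -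
          (unitS₂ (sfStep Lc n) (smStep d Lc n) (T2Of d Lc cE cVH cΛ cE₂ cB Tc vh₂S mixFF n)) κ u κ' u') =
      transport (fun j => lin4 (cE₂ * (Lc : ℝ) ^ (2 * (d + 1))) (unitK (sfStep Lc j) (smStep d Lc j) (KInvStep (d := d) Lc j)) Lc) 1 n
            (fun κ u κ' u' => (unitS₂ (sfStep Lc 1) (smStep d Lc 1) (T2Of d Lc cE cVH cΛ cE₂ cB Tc vh₂S mixFF 1)) κ u κ' u' -
            (unitS₂ (sfStep Lc 0) (smStep d Lc 0) (T2Of d Lc cE cVH cΛ cE₂ cB Tc vh₂S mixFF 0)) κ u κ' u') +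
        ∑ i ∈ Finset.range n, transport (fun j => lin4 (cE₂ * (Lc : ℝ) ^ (2 * (d + 1)))
              (unitK (sfStep Lc j) (smStep d Lc j) (KInvStep (d := d) Lc j)) Lc) (i + 2) (n - 1 - i)
          ((lin4 (cE₂ * (Lc : ℝ) ^ (2 * (d + 1))) (unitK (sfStep Lc (i + 1)) (smStep d Lc (i + 1)) (KInvStep (d := d) Lc (i + 1))) Lc
                (unitS₂ (sfStep Lc i) (smStep d Lc i) (T2Of d Lc cE cVH cΛ cE₂ cB Tc vh₂S mixFF i)) - lin4 (cE₂ * (Lc : ℝ) ^ (2 * (d + 1)))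
                (unitK (sfStep Lc i) (smStep d Lc i) (KInvStep (d := d) Lc i)) Lc (unitS₂ (sfStep Lc i) (smStep d Lc i)
                (T2Of d Lc cE cVH cΛ cE₂ cB Tc vh₂S mixFF i))) + ((fun κ u κ' u' => (cE₂ * (Lc : ℝ) ^ (2 * (d + 1))) • mmRead Lc (K3OfK
                (unitK (sfStep Lc (i + 1)) (smStep d Lc (i + 1)) (KInvStep (d := d) Lc (i + 1))) Lc
                (unitS (sfStep Lc (i + 1)) (smStep d Lc (i + 1)) (Spure d Lc cE cVH cΛ (i + 1)))
                (unitM (sfStep Lc (i + 1)) (smStep d Lc (i + 1)) (M1 d Lc cΛ (i + 1))) (W2SymOfK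
                (unitK (sfStep Lc (i + 1)) (smStep d Lc (i + 1)) (KInvStep (d := d) Lc (i + 1))) Lc
                (unitS (sfStep Lc (i + 1)) (smStep d Lc (i + 1)) (Spure d Lc cE cVH cΛ (i + 1)))
                (unitM (sfStep Lc (i + 1)) (smStep d Lc (i + 1)) (M1 d Lc cΛ (i + 1))) 0
                (unitM₂ (sfStep Lc (i + 1)) (smStep d Lc (i + 1)) (M2Of d Lc mixFF (i + 1)))) κ u κ' u') + cB • mfNeg (vh₂S κ u κ' u')) -
                (fun κ u κ' u' => (cE₂ * (Lc : ℝ) ^ (2 * (d + 1))) • mmRead Lc (K3OfK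
                (unitK (sfStep Lc i) (smStep d Lc i) (KInvStep (d := d) Lc i)) Lc (unitS (sfStep Lc i) (smStep d Lc i) (Spure d Lc cE cVH cΛ i))
                (unitM (sfStep Lc i) (smStep d Lc i) (M1 d Lc cΛ i)) (W2SymOfK (unitK (sfStep Lc i) (smStep d Lc i) (KInvStep (d := d) Lc i)) Lc
                (unitS (sfStep Lc i) (smStep d Lc i) (Spure d Lc cE cVH cΛ i)) (unitM (sfStep Lc i) (smStep d Lc i) (M1 d Lc cΛ i)) 0
                (unitM₂ (sfStep Lc i) (smStep d Lc i) (M2Of d Lc mixFF i))) κ u κ' u') + cB • mfNeg (vh₂S κ u κ' u')))) := by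
  have hrec : ∀ j, (unitS₂ (sfStep Lc (j + 1)) (smStep d Lc (j + 1))
        (T2Of d Lc cE cVH cΛ cE₂ cB Tc vh₂S mixFF (j + 1))) = lin4 (cE₂ * (Lc : ℝ) ^ (2 * (d + 1)))
        (unitK (sfStep Lc j) (smStep d Lc j) (KInvStep (d := d) Lc j)) Lc (unitS₂ (sfStep Lc j) (smStep d Lc j)
        (T2Of d Lc cE cVH cΛ cE₂ cB Tc vh₂S mixFF j)) + (fun κ u κ' u' => (cE₂ * (Lc : ℝ) ^ (2 * (d + 1))) • mmRead Lc (K3OfK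
        (unitK (sfStep Lc j) (smStep d Lc j) (KInvStep (d := d) Lc j)) Lc (unitS (sfStep Lc j) (smStep d Lc j) (Spure d Lc cE cVH cΛ j))
        (unitM (sfStep Lc j) (smStep d Lc j) (M1 d Lc cΛ j)) (W2SymOfK (unitK (sfStep Lc j) (smStep d Lc j) (KInvStep (d := d) Lc j)) Lc
        (unitS (sfStep Lc j) (smStep d Lc j) (Spure d Lc cE cVH cΛ j)) (unitM (sfStep Lc j) (smStep d Lc j) (M1 d Lc cΛ j)) 0
        (unitM₂ (sfStep Lc j) (smStep d Lc j) (M2Of d Lc mixFF j))) κ u κ' u') + cB • mfNeg (vh₂S κ u κ' u')) := fun j => by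
    obtain ⟨C, δ, C₀, C₁, hδ, hK, h₀, hW⟩ := hdat j
    exact unitS₂_T2Of_succ_eq_lin4_add cE cVH cΛ cE₂ cB Tc vh₂S mixFF hBff hBmm j hδ hK h₀ hW
  have hAP : ∀ (j : ℕ) (X : Fin (d + 1) → (Fin (d + 1) → ℤ) → Fin (d + 1) → (Fin (d + 1) → ℤ) → MKer (d + 1) (Fib d)),
      (∃ B : ℝ, ∀ κ u κ' u' x z a b, |X κ u κ' u' x z a b| ≤ B) →
        ∃ B : ℝ, ∀ κ u κ' u' x z a b, |lin4 (cE₂ * (Lc : ℝ) ^ (2 * (d + 1)))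
              (unitK (sfStep Lc j) (smStep d Lc j) (KInvStep (d := d) Lc j)) Lc X κ u κ' u' x z a b| ≤ B := fun j X hX => by
    obtain ⟨C, δ, C₀, C₁, hδ, hK, -, -⟩ := hdat j
    exact lin4_bdd hK hδ _ Lc hX
  have hAadd : ∀ (j : ℕ) (X Y : Fin (d + 1) → (Fin (d + 1) → ℤ) → Fin (d + 1) → (Fin (d + 1) → ℤ) → MKer (d + 1) (Fib d)),
      (∃ B : ℝ, ∀ κ u κ' u' x z a b, |X κ u κ' u' x z a b| ≤ B) → (∃ B : ℝ, ∀ κ u κ' u' x z a b, |Y κ u κ' u' x z a b| ≤ B) →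
        lin4 (cE₂ * (Lc : ℝ) ^ (2 * (d + 1)))
              (unitK (sfStep Lc j) (smStep d Lc j) (KInvStep (d := d) Lc j)) Lc (X + Y) = lin4 (cE₂ * (Lc : ℝ) ^ (2 * (d + 1)))
              (unitK (sfStep Lc j) (smStep d Lc j) (KInvStep (d := d) Lc j)) Lc X + lin4 (cE₂ * (Lc : ℝ) ^ (2 * (d + 1)))
              (unitK (sfStep Lc j) (smStep d Lc j) (KInvStep (d := d) Lc j)) Lc Y := fun j X Y hX hY => by
    obtain ⟨C, δ, C₀, C₁, hδ, hK, -, -⟩ := hdat j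
    exact lin4_add_of_bdd₄ hK hδ _ Lc hX hY
  have hb : ∀ j, ∃ B : ℝ, ∀ κ u κ' u' x z a b, |(fun κ u κ' u' => (cE₂ * (Lc : ℝ) ^ (2 * (d + 1))) • mmRead Lc (K3OfK
        (unitK (sfStep Lc j) (smStep d Lc j) (KInvStep (d := d) Lc j)) Lc (unitS (sfStep Lc j) (smStep d Lc j) (Spure d Lc cE cVH cΛ j))
        (unitM (sfStep Lc j) (smStep d Lc j) (M1 d Lc cΛ j)) (W2SymOfK (unitK (sfStep Lc j) (smStep d Lc j) (KInvStep (d := d) Lc j)) Lc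
        (unitS (sfStep Lc j) (smStep d Lc j) (Spure d Lc cE cVH cΛ j)) (unitM (sfStep Lc j) (smStep d Lc j) (M1 d Lc cΛ j)) 0
        (unitM₂ (sfStep Lc j) (smStep d Lc j) (M2Of d Lc mixFF j))) κ u κ' u') + cB • mfNeg (vh₂S κ u κ' u')) κ u κ' u' x z a b| ≤ B := fun j => by
    have e : (fun κ u κ' u' => (cE₂ * (Lc : ℝ) ^ (2 * (d + 1))) • mmRead Lc (K3OfK (unitK (sfStep Lc j) (smStep d Lc j) (KInvStep (d := d) Lc j)) Lc
          (unitS (sfStep Lc j) (smStep d Lc j) (Spure d Lc cE cVH cΛ j)) (unitM (sfStep Lc j) (smStep d Lc j) (M1 d Lc cΛ j)) (W2SymOfK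
          (unitK (sfStep Lc j) (smStep d Lc j) (KInvStep (d := d) Lc j)) Lc (unitS (sfStep Lc j) (smStep d Lc j) (Spure d Lc cE cVH cΛ j))
          (unitM (sfStep Lc j) (smStep d Lc j) (M1 d Lc cΛ j)) 0
          (unitM₂ (sfStep Lc j) (smStep d Lc j) (M2Of d Lc mixFF j))) κ u κ' u') + cB • mfNeg (vh₂S κ u κ' u')) =
          (unitS₂ (sfStep Lc (j + 1)) (smStep d Lc (j + 1))
          (T2Of d Lc cE cVH cΛ cE₂ cB Tc vh₂S mixFF (j + 1))) - lin4 (cE₂ * (Lc : ℝ) ^ (2 * (d + 1)))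
          (unitK (sfStep Lc j) (smStep d Lc j) (KInvStep (d := d) Lc j)) Lc (unitS₂ (sfStep Lc j) (smStep d Lc j)
          (T2Of d Lc cE cVH cΛ cE₂ cB Tc vh₂S mixFF j)) := by rw [hrec j, add_sub_cancel_left]
    rw [e]
    exact bdd₄_sub (hbdd (j + 1)) (hAP j _ (hbdd j))
  have h := diff_eq_transport_add_sum (A := fun j => lin4 (cE₂ * (Lc : ℝ) ^ (2 * (d + 1)))
        (unitK (sfStep Lc j) (smStep d Lc j) (KInvStep (d := d) Lc j)) Lc)
    (P := fun X => ∃ B : ℝ, ∀ κ u κ' u' x z a b, |X κ u κ' u' x z a b| ≤ B)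
    (x := fun j => (unitS₂ (sfStep Lc j) (smStep d Lc j) (T2Of d Lc cE cVH cΛ cE₂ cB Tc vh₂S mixFF j))) (b := fun j =>
          (fun κ u κ' u' => (cE₂ * (Lc : ℝ) ^ (2 * (d + 1))) • mmRead Lc (K3OfK (unitK (sfStep Lc j) (smStep d Lc j) (KInvStep (d := d) Lc j)) Lc
          (unitS (sfStep Lc j) (smStep d Lc j) (Spure d Lc cE cVH cΛ j)) (unitM (sfStep Lc j) (smStep d Lc j) (M1 d Lc cΛ j)) (W2SymOfK
          (unitK (sfStep Lc j) (smStep d Lc j) (KInvStep (d := d) Lc j)) Lc (unitS (sfStep Lc j) (smStep d Lc j) (Spure d Lc cE cVH cΛ j))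
          (unitM (sfStep Lc j) (smStep d Lc j) (M1 d Lc cΛ j)) 0
          (unitM₂ (sfStep Lc j) (smStep d Lc j) (M2Of d Lc mixFF j))) κ u κ' u') + cB • mfNeg (vh₂S κ u κ' u'))) bdd₄_zero (fun _ _ => bdd₄_add) (fun
          _ _ => bdd₄_sub) hAP hAadd (hbdd 0) hb hrec n
  have e1 : (fun κ u κ' u' => (unitS₂ (sfStep Lc (n + 1)) (smStep d Lc (n + 1)) (T2Of d Lc cE cVH cΛ cE₂ cB Tc vh₂S mixFF (n + 1))) κ u κ' u' -
        (unitS₂ (sfStep Lc n) (smStep d Lc n) (T2Of d Lc cE cVH cΛ cE₂ cB Tc vh₂S mixFF n)) κ u κ' u') =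
        (unitS₂ (sfStep Lc (n + 1)) (smStep d Lc (n + 1)) (T2Of d Lc cE cVH cΛ cE₂ cB Tc vh₂S mixFF (n + 1))) - (unitS₂ (sfStep Lc n) (smStep d Lc n)
        (T2Of d Lc cE cVH cΛ cE₂ cB Tc vh₂S mixFF n)) := rfl
  have e0 : (fun κ u κ' u' => (unitS₂ (sfStep Lc 1) (smStep d Lc 1) (T2Of d Lc cE cVH cΛ cE₂ cB Tc vh₂S mixFF 1)) κ u κ' u' -
        (unitS₂ (sfStep Lc 0) (smStep d Lc 0) (T2Of d Lc cE cVH cΛ cE₂ cB Tc vh₂S mixFF 0)) κ u κ' u') = (unitS₂ (sfStep Lc 1) (smStep d Lc 1)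
        (T2Of d Lc cE cVH cΛ cE₂ cB Tc vh₂S mixFF 1)) - (unitS₂ (sfStep Lc 0) (smStep d Lc 0) (T2Of d Lc cE cVH cΛ cE₂ cB Tc vh₂S mixFF 0)) := rfl
  rw [e1, e0]
  exact h

end Generic

/-! ## §2 The level sums for an1's border table `vh₂S d Lc` (the row owner's literal texts) -/

section Concrete

variable {Lc : ℕ} [NeZero Lc] (cE cVH cΛ cE₂ cB : ℝ) (Tc : Fin 4 → Fin 4 → Fin 4 → Fin 4 → ℝ)
  (mixFF : Fin (d + 1) → (Fin (d + 1) → ℤ) → Fin (d + 1) → (Fin (d + 1) → ℤ) → MKer (d + 1) (Fib d))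


/-- [folklore] **(F1) FOR an1's BORDER TABLE** — the `hsplit` text of `WSlotT2OfPieces.t2Shape_of_rows` (`P := transport (fun j ↦ lin4 c₄ K♮_j Lc)`,
`b := b♮`), under leaf-04's per-level step data and bounded entries of the normalised members. -/
theorem unitS₂_T2Of_eq_transport_add_sum_vh₂S
    (hdat : ∀ j, ∃ C δ C₀ C₁ : ℝ, 0 < δ ∧ Decays (unitK (sfStep Lc j) (smStep d Lc j) (KInvStep (d := d) Lc j)) C δ ∧ VertexFamily₂ (W2SymOfK
          (unitK (sfStep Lc j) (smStep d Lc j) (KInvStep (d := d) Lc j)) Lc (unitS (sfStep Lc j) (smStep d Lc j) (Spure d Lc cE cVH cΛ j))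
          (unitM (sfStep Lc j) (smStep d Lc j) (M1 d Lc cΛ j)) 0 (unitM₂ (sfStep Lc j) (smStep d Lc j) (M2Of d Lc mixFF j))) Lc C₀ δ ∧
      VertexFamily₂ (W2SymOfK (unitK (sfStep Lc j) (smStep d Lc j) (KInvStep (d := d) Lc j)) Lc
            (unitS (sfStep Lc j) (smStep d Lc j) (Spure d Lc cE cVH cΛ j)) (unitM (sfStep Lc j) (smStep d Lc j) (M1 d Lc cΛ j))
            (unitS₂ (sfStep Lc j) (smStep d Lc j) (T2Of d Lc cE cVH cΛ cE₂ cB Tc (vh₂S d Lc) mixFF j))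
            (unitM₂ (sfStep Lc j) (smStep d Lc j) (M2Of d Lc mixFF j))) Lc C₁ δ)
    (hbdd : ∀ j, ∃ B : ℝ, ∀ κ u κ' u' x z a b, |(unitS₂ (sfStep Lc j) (smStep d Lc j)
          (T2Of d Lc cE cVH cΛ cE₂ cB Tc (vh₂S d Lc) mixFF j)) κ u κ' u' x z a b| ≤ B) (n : ℕ) :
    (unitS₂ (sfStep Lc n) (smStep d Lc n)
          (T2Of d Lc cE cVH cΛ cE₂ cB Tc (vh₂S d Lc) mixFF n)) = transport (fun j => lin4 (cE₂ * (Lc : ℝ) ^ (2 * (d + 1)))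
          (unitK (sfStep Lc j) (smStep d Lc j) (KInvStep (d := d) Lc j)) Lc) 0 n (unitS₂ (sfStep Lc 0) (smStep d Lc 0)
          (T2Of d Lc cE cVH cΛ cE₂ cB Tc (vh₂S d Lc) mixFF 0)) +
      ∑ i ∈ Finset.range n, transport (fun j => lin4 (cE₂ * (Lc : ℝ) ^ (2 * (d + 1)))
            (unitK (sfStep Lc j) (smStep d Lc j) (KInvStep (d := d) Lc j)) Lc) (i + 1) (n - 1 - i)
            (fun κ u κ' u' => (cE₂ * (Lc : ℝ) ^ (2 * (d + 1))) • mmRead Lc (K3OfK (unitK (sfStep Lc i) (smStep d Lc i) (KInvStep (d := d) Lc i)) Lc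
            (unitS (sfStep Lc i) (smStep d Lc i) (Spure d Lc cE cVH cΛ i)) (unitM (sfStep Lc i) (smStep d Lc i) (M1 d Lc cΛ i)) (W2SymOfK
            (unitK (sfStep Lc i) (smStep d Lc i) (KInvStep (d := d) Lc i)) Lc (unitS (sfStep Lc i) (smStep d Lc i) (Spure d Lc cE cVH cΛ i))
            (unitM (sfStep Lc i) (smStep d Lc i) (M1 d Lc cΛ i)) 0
            (unitM₂ (sfStep Lc i) (smStep d Lc i) (M2Of d Lc mixFF i))) κ u κ' u') + cB • mfNeg ((vh₂S d Lc) κ u κ' u')) :=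
  unitS₂_T2Of_eq_transport_add_sum cE cVH cΛ cE₂ cB Tc (vh₂S d Lc) mixFF (vh₂S_inl_inl Lc) (vh₂S_inr_inr Lc) hdat hbdd n

/-- [folklore] **(F1) FOR THE DIFFERENCE TOWER, an1's BORDER TABLE** — the `hsplit` text of `WSlotT2OfPieces.t2Drift_of_rows`
(`P m k := transport (fun j ↦ lin4 c₄ K♮_j Lc) (m+1) k`, `f i := (𝒜_{i+1} − 𝒜_i)[T♮_i] + (b♮_{i+1} − b♮_i)`). -/
theorem unitS₂_T2Of_sub_eq_transport_add_sum_vh₂S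
    (hdat : ∀ j, ∃ C δ C₀ C₁ : ℝ, 0 < δ ∧ Decays (unitK (sfStep Lc j) (smStep d Lc j) (KInvStep (d := d) Lc j)) C δ ∧ VertexFamily₂ (W2SymOfK
          (unitK (sfStep Lc j) (smStep d Lc j) (KInvStep (d := d) Lc j)) Lc (unitS (sfStep Lc j) (smStep d Lc j) (Spure d Lc cE cVH cΛ j))
          (unitM (sfStep Lc j) (smStep d Lc j) (M1 d Lc cΛ j)) 0 (unitM₂ (sfStep Lc j) (smStep d Lc j) (M2Of d Lc mixFF j))) Lc C₀ δ ∧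
      VertexFamily₂ (W2SymOfK (unitK (sfStep Lc j) (smStep d Lc j) (KInvStep (d := d) Lc j)) Lc
            (unitS (sfStep Lc j) (smStep d Lc j) (Spure d Lc cE cVH cΛ j)) (unitM (sfStep Lc j) (smStep d Lc j) (M1 d Lc cΛ j))
            (unitS₂ (sfStep Lc j) (smStep d Lc j) (T2Of d Lc cE cVH cΛ cE₂ cB Tc (vh₂S d Lc) mixFF j))
            (unitM₂ (sfStep Lc j) (smStep d Lc j) (M2Of d Lc mixFF j))) Lc C₁ δ)
    (hbdd : ∀ j, ∃ B : ℝ, ∀ κ u κ' u' x z a b, |(unitS₂ (sfStep Lc j) (smStep d Lc j)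
          (T2Of d Lc cE cVH cΛ cE₂ cB Tc (vh₂S d Lc) mixFF j)) κ u κ' u' x z a b| ≤ B) (n : ℕ) :
    (fun κ u κ' u' => (unitS₂ (sfStep Lc (n + 1)) (smStep d Lc (n + 1)) (T2Of d Lc cE cVH cΛ cE₂ cB Tc (vh₂S d Lc) mixFF (n + 1))) κ u κ' u' -
          (unitS₂ (sfStep Lc n) (smStep d Lc n) (T2Of d Lc cE cVH cΛ cE₂ cB Tc (vh₂S d Lc) mixFF n)) κ u κ' u') =
      transport (fun j => lin4 (cE₂ * (Lc : ℝ) ^ (2 * (d + 1))) (unitK (sfStep Lc j) (smStep d Lc j) (KInvStep (d := d) Lc j)) Lc) 1 n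
            (fun κ u κ' u' => (unitS₂ (sfStep Lc 1) (smStep d Lc 1) (T2Of d Lc cE cVH cΛ cE₂ cB Tc (vh₂S d Lc) mixFF 1)) κ u κ' u' -
            (unitS₂ (sfStep Lc 0) (smStep d Lc 0) (T2Of d Lc cE cVH cΛ cE₂ cB Tc (vh₂S d Lc) mixFF 0)) κ u κ' u') +
        ∑ i ∈ Finset.range n, transport (fun j => lin4 (cE₂ * (Lc : ℝ) ^ (2 * (d + 1)))
              (unitK (sfStep Lc j) (smStep d Lc j) (KInvStep (d := d) Lc j)) Lc) (i + 2) (n - 1 - i)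
          ((lin4 (cE₂ * (Lc : ℝ) ^ (2 * (d + 1))) (unitK (sfStep Lc (i + 1)) (smStep d Lc (i + 1)) (KInvStep (d := d) Lc (i + 1))) Lc
                (unitS₂ (sfStep Lc i) (smStep d Lc i) (T2Of d Lc cE cVH cΛ cE₂ cB Tc (vh₂S d Lc) mixFF i)) - lin4 (cE₂ * (Lc : ℝ) ^ (2 * (d + 1)))
                (unitK (sfStep Lc i) (smStep d Lc i) (KInvStep (d := d) Lc i)) Lc (unitS₂ (sfStep Lc i) (smStep d Lc i)
                (T2Of d Lc cE cVH cΛ cE₂ cB Tc (vh₂S d Lc) mixFF i))) + ((fun κ u κ' u' => (cE₂ * (Lc : ℝ) ^ (2 * (d + 1))) • mmRead Lc (K3OfK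
                (unitK (sfStep Lc (i + 1)) (smStep d Lc (i + 1)) (KInvStep (d := d) Lc (i + 1))) Lc
                (unitS (sfStep Lc (i + 1)) (smStep d Lc (i + 1)) (Spure d Lc cE cVH cΛ (i + 1)))
                (unitM (sfStep Lc (i + 1)) (smStep d Lc (i + 1)) (M1 d Lc cΛ (i + 1))) (W2SymOfK
                (unitK (sfStep Lc (i + 1)) (smStep d Lc (i + 1)) (KInvStep (d := d) Lc (i + 1))) Lc
                (unitS (sfStep Lc (i + 1)) (smStep d Lc (i + 1)) (Spure d Lc cE cVH cΛ (i + 1)))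
                (unitM (sfStep Lc (i + 1)) (smStep d Lc (i + 1)) (M1 d Lc cΛ (i + 1))) 0
                (unitM₂ (sfStep Lc (i + 1)) (smStep d Lc (i + 1)) (M2Of d Lc mixFF (i + 1)))) κ u κ' u') + cB • mfNeg ((vh₂S d Lc) κ u κ' u')) -
                (fun κ u κ' u' => (cE₂ * (Lc : ℝ) ^ (2 * (d + 1))) • mmRead Lc (K3OfK
                (unitK (sfStep Lc i) (smStep d Lc i) (KInvStep (d := d) Lc i)) Lc (unitS (sfStep Lc i) (smStep d Lc i) (Spure d Lc cE cVH cΛ i))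
                (unitM (sfStep Lc i) (smStep d Lc i) (M1 d Lc cΛ i)) (W2SymOfK (unitK (sfStep Lc i) (smStep d Lc i) (KInvStep (d := d) Lc i)) Lc
                (unitS (sfStep Lc i) (smStep d Lc i) (Spure d Lc cE cVH cΛ i)) (unitM (sfStep Lc i) (smStep d Lc i) (M1 d Lc cΛ i)) 0
                (unitM₂ (sfStep Lc i) (smStep d Lc i) (M2Of d Lc mixFF i))) κ u κ' u') + cB • mfNeg ((vh₂S d Lc) κ u κ' u')))) :=
  unitS₂_T2Of_sub_eq_transport_add_sum cE cVH cΛ cE₂ cB Tc (vh₂S d Lc) mixFF (vh₂S_inl_inl Lc) (vh₂S_inr_inr Lc) hdat hbdd n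

end Concrete


end Summit.QuantumFields.BalabanUV.Beta.GAN24.T2UnitSplitLevels

end
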